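import Summits.Ventures.PercRepro.ProfilePointedCircuitClassesFive

/-!
# PercRepro — THE BOTTOM-LEVEL PER-CIRCUIT CLAIM AT NULLITY 5, V: THE CLASS `#C = 1` (`x ∥ w`), THEOREM A TWO SIZES DOWN
(p5, gen 37; `proofs/P5-GM1.md` §53(a), the case `c = 1` of the reduction; the nullity-4 template is
`ProfilePointedCircuitClassesOne`)

When the fundamental circuit of `x` in a captured set is `{x, w}` (`x ∥ w`), the class at every level `k` is
`{W ∈ BI_k : w ∈ W, x ∉ W}`, in bijection (`W ↦ W − w`) with the bi-independent `(k − 1)`-sets of the minor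
`N ／ w ∖ x` — a matroid of nullity `4` and rank `ρ(E) − 1 ≥ 6` on `n − 2` points — so the per-circuit claim
`γ_C(5) ≤ γ_C(n − 6)` is `P_4 ≤ P_5` there: the kernel's `biIndep_step_four_of_nullity_four`.
-/

open scoped Matroid

namespace PercRepro.Cogirth

open Finset ThmH Skew Shadow Profile

variable {α : Type} [DecidableEq α] {N : Matroid α} [N.Finite]

section FiveOne

/-- THE CLASS `#C = 1` AT NULLITY 5 (`x ∥ w`; §53(e), the bridge: the class at every level `k` is
`{W ∈ BI_k : w ∈ W, x ∉ W}`, in bijection (`W ↦ W − w`) with the bi-independent `(k − 1)`-sets of `N ／ w ∖ x`, a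
matroid of nullity `4` and rank `ρ(E) − 1 ≥ 6` on `n − 2` points, so `γ_C(5) ≤ γ_C(n − 6)` is `P_4 ≤ P_5` there —
the kernel's `biIndep_step_four_of_nullity_four`). -/
theorem gammaC_five_le_of_card_eq_one (hn : (gr N).card = rk N (gr N) + 5) (hR : 7 ≤ rk N (gr N))
    (x : α) {C : Finset α} (hC : C.card = 1) : gammaC N 5 x C ≤ gammaC N ((gr N).card - 6) x C := by
  obtain ⟨w, rfl⟩ := card_eq_one.1 hC
  unfold gammaC
  rcases ((biIndepSets N 5).filter (fun W => x ∉ W ∧ x ∈ clF N W ∧ fundC N W x = {w})).eq_empty_or_nonempty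
    with hemp | ⟨W₀, hW₀⟩
  · rw [hemp, card_empty]
    exact Nat.zero_le _
  rw [mem_filter, mem_biIndepSets] at hW₀
  obtain ⟨⟨hW₀g, hW₀card, hW₀rk, hW₀compl⟩, hxW₀, hxcl₀, hfund₀⟩ := hW₀
  have hwW₀ : w ∈ W₀ := by
    have : w ∈ fundC N W₀ x := by rw [hfund₀]; exact mem_singleton_self w
    exact fundC_subset W₀ x this
  have hwg : w ∈ gr N := hW₀g hwW₀
  have hxg : x ∈ gr N := clF_subset_gr W₀ hxcl₀
  have hxw : x ≠ w := fun h => hxW₀ (h ▸ hwW₀)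
  -- `x ∥ w`
  have hxclw : x ∈ clF N {w} := by
    have h := mem_clF_sdiff_of_forall_notMem_fundC hxg hW₀g hW₀rk hxcl₀ (W₀.erase w) (erase_subset w W₀)
      (fun w' hw' => by rw [hfund₀, mem_singleton]; exact (mem_erase.1 hw').1)
    have e : W₀ \ W₀.erase w = {w} := by
      ext a
      simp only [mem_sdiff, mem_erase, mem_singleton, not_and]
      constructor
      · rintro ⟨ha, h2⟩
        by_contra hne
        exact h2 hne ha
      · rintro rfl
        exact ⟨hwW₀, fun h => absurd rfl h⟩
    rwa [e] at h
  have hw1 : rk N {w} = 1 := by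
    have h := rk_eq_card_of_subset_of_rk_eq_card (singleton_subset_iff.2 hwW₀) hW₀rk
    rwa [card_singleton] at h
  have hx1 : rk N {x} = 1 := by
    have h := rk_eq_card_of_subset_of_rk_eq_card (singleton_subset_iff.2 (mem_sdiff.2 ⟨hxg, hxW₀⟩)) hW₀compl
    rwa [card_singleton] at h
  have hwclx : w ∈ clF N {x} := by
    have h1 : rk N (insert x {w}) = rk N {w} := by
      rw [rk_insert_eq hxg (singleton_subset_iff.2 hwg), if_pos hxclw]
    have h2 : insert x ({w} : Finset α) = insert w ({x} : Finset α) := by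
      ext a; simp only [mem_insert, mem_singleton]; tauto
    have h3 := rk_insert_eq hwg (singleton_subset_iff.2 hxg) (M := N) (e := w) (X := {x})
    rw [← h2, h1, hw1, hx1] at h3
    by_contra hc
    rw [if_neg hc] at h3
    omega
  -- the class at every level is `{W ∈ BI_k : w ∈ W, x ∉ W}`
  have hclass : ∀ k : ℕ, ∀ W ∈ biIndepSets N k,
      ((x ∉ W ∧ x ∈ clF N W ∧ fundC N W x = {w}) ↔ (w ∈ W ∧ x ∉ W)) := by
    intro k W hW
    rw [mem_biIndepSets] at hW
    obtain ⟨hWg, hWcard, hWrk, hWcompl⟩ := hW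
    constructor
    · rintro ⟨hxW, _, hfund⟩
      refine ⟨?_, hxW⟩
      have : w ∈ fundC N W x := by rw [hfund]; exact mem_singleton_self w
      exact fundC_subset W x this
    · rintro ⟨hwW, hxW⟩
      have hxcl : x ∈ clF N W := mem_clF_of_subset (singleton_subset_iff.2 hwW) hxclw
      refine ⟨hxW, hxcl, ?_⟩
      ext w'
      unfold fundC
      rw [mem_filter, mem_singleton]
      constructor
      · rintro ⟨hw'W, hx'⟩
        by_contra hne
        have hsub : {w} ⊆ W.erase w' := singleton_subset_iff.2 (mem_erase.2 ⟨fun h => hne h.symm, hwW⟩)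
        exact hx' (mem_clF_of_subset hsub hxclw)
      · rintro rfl
        refine ⟨hwW, ?_⟩
        intro hx'
        have hWe : W.erase w' ⊆ gr N := (erase_subset w' W).trans hWg
        have r1 : rk N (insert x (W.erase w')) = rk N (W.erase w') := by
          rw [rk_insert_eq hxg hWe, if_pos hx']
        have hwcl' : w' ∈ clF N (insert x (W.erase w')) :=
          mem_clF_of_subset (singleton_subset_iff.2 (mem_insert_self x _)) hwclx
        have r2 : rk N (insert w' (insert x (W.erase w'))) = rk N (insert x (W.erase w')) := by
          rw [rk_insert_eq (hWg hwW) ((insert_subset_iff).2 ⟨hxg, hWe⟩), if_pos hwcl']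
        have e : insert w' (insert x (W.erase w')) = insert x W := by
          ext a
          simp only [mem_insert, mem_erase]
          constructor
          · rintro (rfl | rfl | ⟨_, h⟩)
            · exact Or.inr hwW
            · exact Or.inl rfl
            · exact Or.inr h
          · rintro (rfl | h)
            · exact Or.inr (Or.inl rfl)
            · by_cases haw : a = w'
              · exact Or.inl haw
              · exact Or.inr (Or.inr ⟨haw, h⟩)
        have r3 : rk N (insert x W) = rk N W := by rw [rk_insert_eq hxg hWg, if_pos hxcl]
        have rWe : rk N (W.erase w') = W.card - 1 := by
          rw [rk_eq_card_of_subset_of_rk_eq_card (erase_subset w' W) hWrk, card_erase_of_mem hwW]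
        have hW1 : 1 ≤ W.card := card_pos.2 ⟨w', hwW⟩
        rw [e, r3, r1, rWe, hWrk] at r2
        omega
  have hfilt : ∀ k : ℕ, (biIndepSets N k).filter (fun W => x ∉ W ∧ x ∈ clF N W ∧ fundC N W x = {w}) =
      (biIndepSets N k).filter (fun W => w ∈ W ∧ x ∉ W) := by
    intro k
    apply filter_congr
    intro W hW
    exact hclass k W hW
  rw [hfilt, hfilt]
  -- the matroid `N ／ w ∖ x`
  have hgr₀ : gr ((N ／ ({w} : Set α)) ＼ ({x} : Set α)) = ((gr N).erase w).erase x := by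
    rw [gr_delete', gr_contract']
  have hwind : N.Indep ({w} : Set α) := by
    have := indep_of_rk_eq_card' (M := N) (X := {w}) (by rw [hw1, card_singleton])
    simpa using this
  have hrk₀ : ∀ X : Finset α, X ⊆ ((gr N).erase w).erase x →
      rk ((N ／ ({w} : Set α)) ＼ ({x} : Set α)) X + 1 = rk N (insert w X) := by
    intro X hX
    have hX' : X ⊆ (gr (N ／ ({w} : Set α))).erase x := by rw [gr_contract']; exact hX
    have hX'' : X ⊆ (gr N).erase w := hX.trans (erase_subset _ _)
    rw [rk_delete hX', rk_contract_add_one hwind hX'']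
  have hcard₀ : (((gr N).erase w).erase x).card = (gr N).card - 2 := by
    rw [card_erase_of_mem (mem_erase.2 ⟨hxw, hxg⟩), card_erase_of_mem hwg]
    omega
  have hrkg₀ : rk ((N ／ ({w} : Set α)) ＼ ({x} : Set α)) (((gr N).erase w).erase x) = rk N (gr N) - 1 := by
    have h := hrk₀ _ (Subset.refl _)
    have e : insert w (((gr N).erase w).erase x) = (gr N).erase x := by
      ext a
      simp only [mem_insert, mem_erase]
      constructor
      · rintro (rfl | ⟨hax, _, hag⟩)
        · exact ⟨fun h => hxw h.symm, hwg⟩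
        · exact ⟨hax, hag⟩
      · rintro ⟨hax, hag⟩
        by_cases haw : a = w
        · exact Or.inl haw
        · exact Or.inr ⟨hax, haw, hag⟩
    have hxcl' : x ∈ clF N ((gr N).erase x) :=
      mem_clF_of_subset (singleton_subset_iff.2 (mem_erase.2 ⟨fun h => hxw h.symm, hwg⟩)) hxclw
    have h2 : rk N (insert x ((gr N).erase x)) = rk N ((gr N).erase x) := by
      rw [rk_insert_eq hxg (erase_subset x (gr N)), if_pos hxcl']
    rw [insert_erase hxg] at h2
    rw [e, ← h2] at h
    omega
  -- the bijection `W ↦ W − w` at every level `k ≥ 1`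
  have hbij : ∀ k : ℕ, 1 ≤ k →
      ((biIndepSets N k).filter (fun W => w ∈ W ∧ x ∉ W)).card =
        (biIndepSets ((N ／ ({w} : Set α)) ＼ ({x} : Set α)) (k - 1)).card := by
    intro k hk
    apply card_nbij' (fun W => W.erase w) (fun X => insert w X)
    · intro W hW
      rw [mem_coe, mem_filter, mem_biIndepSets] at hW
      obtain ⟨⟨hWg, hWcard, hWrk, hWcompl⟩, hwW, hxW⟩ := hW
      rw [mem_coe, mem_biIndepSets, hgr₀]
      simp only
      have hWeg : W.erase w ⊆ ((gr N).erase w).erase x := by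
        intro a ha
        rw [mem_erase] at ha
        exact mem_erase.2 ⟨fun h => hxW (h ▸ ha.2), mem_erase.2 ⟨ha.1, hWg ha.2⟩⟩
      refine ⟨hWeg, ?_, ?_, ?_⟩
      · rw [card_erase_of_mem hwW, hWcard]
      · have h := hrk₀ (W.erase w) hWeg
        rw [insert_erase hwW, hWrk] at h
        rw [card_erase_of_mem hwW]
        omega
      · have e : ((gr N).erase w).erase x \ W.erase w = (gr N \ W).erase x := by
          ext a
          simp only [mem_sdiff, mem_erase]
          constructor
          · rintro ⟨⟨hax, haw, hag⟩, h⟩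
            exact ⟨hax, hag, fun haW => h ⟨haw, haW⟩⟩
          · rintro ⟨hax, hag, haW⟩
            exact ⟨⟨hax, fun h => haW (h ▸ hwW), hag⟩, fun h => haW h.2⟩
        rw [e]
        have hYg : (gr N \ W).erase x ⊆ ((gr N).erase w).erase x := by rw [← e]; exact sdiff_subset
        have h := hrk₀ _ hYg
        have hxY : x ∉ (gr N \ W).erase x := fun h => (mem_erase.1 h).1 rfl
        have hwY : w ∉ (gr N \ W).erase x := fun h => (mem_sdiff.1 (mem_erase.1 h).2).2 hwW
        have eY : insert x ((gr N \ W).erase x) = gr N \ W := insert_erase (mem_sdiff.2 ⟨hxg, hxW⟩)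
        have hYind : rk N (gr N \ W) = ((gr N \ W).erase x).card + 1 := by
          rw [hWcompl, card_erase_of_mem (mem_sdiff.2 ⟨hxg, hxW⟩)]
          have : 0 < (gr N \ W).card := card_pos.2 ⟨x, mem_sdiff.2 ⟨hxg, hxW⟩⟩
          omega
        have hxclY : x ∈ clF N (insert w ((gr N \ W).erase x)) :=
          mem_clF_of_subset (singleton_subset_iff.2 (mem_insert_self w _)) hxclw
        have hYwg : insert w ((gr N \ W).erase x) ⊆ gr N :=
          insert_subset hwg ((erase_subset _ _).trans sdiff_subset)
        have r1 : rk N (insert x (insert w ((gr N \ W).erase x))) = rk N (insert w ((gr N \ W).erase x)) := by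
          rw [rk_insert_eq hxg hYwg, if_pos hxclY]
        have r2 : rk N (insert x ((gr N \ W).erase x)) ≤ rk N (insert x (insert w ((gr N \ W).erase x))) :=
          rk_le_rk_of_subset_finset (insert_subset_insert x (subset_insert w _))
        have r3 : rk N (insert w ((gr N \ W).erase x)) ≤ (insert w ((gr N \ W).erase x)).card := rk_le_card _
        rw [card_insert_of_notMem hwY] at r3
        rw [eY, hYind, r1] at r2
        omega
    · intro X hX
      rw [mem_coe, mem_biIndepSets, hgr₀] at hX
      obtain ⟨hXg, hXcard, hXrk, hXcompl⟩ := hX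
      have hwX : w ∉ X := fun h => (mem_erase.1 (mem_erase.1 (hXg h)).2).1 rfl
      have hxX : x ∉ X := fun h => (mem_erase.1 (hXg h)).1 rfl
      rw [mem_coe, mem_filter, mem_biIndepSets]
      simp only
      have hXg' : X ⊆ gr N := hXg.trans ((erase_subset _ _).trans (erase_subset _ _))
      refine ⟨⟨insert_subset hwg hXg', ?_, ?_, ?_⟩, mem_insert_self w X, ?_⟩
      · rw [card_insert_of_notMem hwX, hXcard]
        omega
      · have h := hrk₀ X hXg
        rw [hXrk, hXcard] at h
        rw [card_insert_of_notMem hwX, hXcard]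
        omega
      · have e : gr N \ insert w X = insert x (((gr N).erase w).erase x \ X) := by
          ext a
          simp only [mem_sdiff, mem_insert, mem_erase, not_or]
          constructor
          · rintro ⟨hag, haw, haX⟩
            by_cases hax : a = x
            · exact Or.inl hax
            · exact Or.inr ⟨⟨hax, haw, hag⟩, haX⟩
          · rintro (rfl | ⟨⟨hax, haw, hag⟩, haX⟩)
            · exact ⟨hxg, hxw, hxX⟩
            · exact ⟨hag, haw, haX⟩
        rw [e]
        have hYg : ((gr N).erase w).erase x \ X ⊆ ((gr N).erase w).erase x := sdiff_subset
        have h := hrk₀ _ hYg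
        have hxY : x ∉ ((gr N).erase w).erase x \ X := fun h => (mem_erase.1 (mem_sdiff.1 h).1).1 rfl
        have hwY : w ∉ ((gr N).erase w).erase x \ X :=
          fun h => (mem_erase.1 (mem_erase.1 (mem_sdiff.1 h).1).2).1 rfl
        rw [hXcompl] at h
        have hwclY : w ∈ clF N (insert x (((gr N).erase w).erase x \ X)) :=
          mem_clF_of_subset (singleton_subset_iff.2 (mem_insert_self x _)) hwclx
        have hYxg : insert x (((gr N).erase w).erase x \ X) ⊆ gr N :=
          insert_subset hxg (hYg.trans ((erase_subset _ _).trans (erase_subset _ _)))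
        have r1 : rk N (insert w (insert x (((gr N).erase w).erase x \ X))) =
            rk N (insert x (((gr N).erase w).erase x \ X)) := by
          rw [rk_insert_eq hwg hYxg, if_pos hwclY]
        have r2 : rk N (insert w (((gr N).erase w).erase x \ X)) ≤
            rk N (insert w (insert x (((gr N).erase w).erase x \ X))) :=
          rk_le_rk_of_subset_finset (insert_subset_insert w (subset_insert x _))
        have r3 : rk N (insert x (((gr N).erase w).erase x \ X)) ≤
            (insert x (((gr N).erase w).erase x \ X)).card := rk_le_card _
        rw [card_insert_of_notMem hxY] at r3 ⊢
        rw [r1] at r2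
        omega
      · exact fun h => hxX ((mem_insert.1 h).resolve_left hxw)
    · intro W hW
      rw [mem_coe, mem_filter] at hW
      exact insert_erase hW.2.1
    · intro X hX
      rw [mem_coe, mem_biIndepSets, hgr₀] at hX
      have hwX : w ∉ X := fun h => (mem_erase.1 (mem_erase.1 (hX.1 h)).2).1 rfl
      exact erase_insert hwX
  rw [hbij 5 (by norm_num), hbij ((gr N).card - 6) (by omega)]
  -- the kernel's nullity-4 theorem on `N ／ w ∖ x`
  have hn₀ : (gr ((N ／ ({w} : Set α)) ＼ ({x} : Set α))).card =
      rk ((N ／ ({w} : Set α)) ＼ ({x} : Set α)) (gr ((N ／ ({w} : Set α)) ＼ ({x} : Set α))) + 4 := by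
    rw [hgr₀, hcard₀, hrkg₀]
    omega
  have hR₀ : 6 ≤ rk ((N ／ ({w} : Set α)) ＼ ({x} : Set α)) (gr ((N ／ ({w} : Set α)) ＼ ({x} : Set α))) := by
    rw [hgr₀, hrkg₀]
    omega
  have hstep := biIndep_step_four_of_nullity_four (N := (N ／ ({w} : Set α)) ＼ ({x} : Set α)) hn₀ hR₀
  have hsym : (biIndepSets ((N ／ ({w} : Set α)) ＼ ({x} : Set α)) ((gr N).card - 6 - 1)).card =
      (biIndepSets ((N ／ ({w} : Set α)) ＼ ({x} : Set α)) 5).card := by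
    have h := card_biIndepSets_symm (M := (N ／ ({w} : Set α)) ＼ ({x} : Set α)) (k := 5)
      (by rw [hgr₀, hcard₀]; omega)
    rw [hgr₀, hcard₀] at h
    have e : (gr N).card - 6 - 1 = (gr N).card - 2 - 5 := by omega
    rw [e, h]
  rw [hsym]
  rw [hgr₀, hcard₀] at hstep
  have h5 : 5 ≤ (gr N).card - 2 - 4 := by omega
  have h6 := Nat.mul_le_mul_right (biIndepSets ((N ／ ({w} : Set α)) ＼ ({x} : Set α)) 4).card h5
  have h7 : (5 : ℕ) - 1 = 4 := by norm_num
  rw [h7]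
  omega


end FiveOne

end PercRepro.Cogirth
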